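import Summits.CriticalPhenomena.PercolationContinuityZ3.Theorems.PercNearOneGluingNoHeavyQuantBlockCombTiedPlusRoot
import Summits.CriticalPhenomena.PercolationContinuityZ3.Theorems.PercNearOneGluingNoHeavyQuantFarTreeBlockCombStrong
import HarnessLib

/-!
# QUANT lane R8, FAR on trees: the block-comb tail is AFFINE in the first chain gate (FAR transfers down the first gate with no
# root-mass hypothesis), and appending a chain gate below every blob does not change the tail

builds on p205010 (kernel theorem, internal audit signed; external expert review pending)

Support file (`--supports stmt-CriticalPhenomena-4575`), QUANT lane seat prim-quant-census-1 (gen 13); memo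
`run/shared/lean/prim/quant/prim-quant-census-1/GENERAL-ROW-G13.md`.  Theorems only (local notation, no definitions), no sorries,
standard axioms.  Model and notation: `…QuantBlockCombMergeModel.lean` (chain gates `q`, levels `lv`, sizes `a`, private gates `g`,
explicit tail `TAIL = P(N ≥ j+1)`; root level `0`; the marginal of blob `k` is `(∏_{i<lv k} q i)·g k`).  First of three files
(`…RootGateAffine`, `…MarkovMerge`, `…GeneralRow`) proving the far-relay row for EVERY block-comb.

* `Quant.BlockComb.tail_rootGate_update_affine` — **the tail is AFFINE in the first chain gate with a NONNEGATIVE intercept** (p1 g8's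
  bookkeeping identity `Quant.BlockCombGate.tail_succ` read at `update q 0 t`): `TAIL[D+1, q 0 := t] = (1 − t)·A₀ + t·TAIL[D, q∘succ, lv − 1]`,
  `A₀ = Σ_S wt S·𝟙[root mass of S ≥ j+1]` (lead g13's `tail_contract_root` / `tail_rootGate` are the case `A₀ = 0`; the root split
  `tail_succ_ge_rootGate_mul` is `t = 1`).
* `Quant.BlockComb.tail_ge_rootGate_mul_of_le` / `tail_ge_of_rootGate_le` — hence **FAR transfers DOWN the first chain gate with NO
  root-mass hypothesis**: for `0 ≤ q 0 ≤ t`, `0 < t`, `(q 0/t)·TAIL[q 0 := t] ≤ TAIL[q]` (the difference is `A₀·(1 − q 0/t) ≥ 0`).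
  Consequence (normal form, strengthening LEAD-NOTES-G13 N24 (1)): FAR may always be proved at the first gate at which the least
  reliable live root blob becomes tied — whatever the root mass.
* `Quant.BlockComb.tail_append_gate` — with live levels `≤ D`, `TAIL[D+1, update q D t] = TAIL[D, q]` for any `t`: a virtual gate
  below the deepest level is invisible (used to put an arbitrary floor `x ≤ ∏ q` in the form `x = ∏ q'`).
-/

namespace Summit.CriticalPhenomena.PercolationContinuityZ3.Theorems

namespace Quant

namespace BlockComb

open Finset

variable {κ : Type*} [Fintype κ] [DecidableEq κ]

/-- product-Bernoulli weight of the set `S` of open blob gates -/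
local notation3 "wt[" g ", " S "]" => ∏ k, (if k ∈ (S : Finset κ) then (g : κ → ℝ) k else 1 - (g : κ → ℝ) k)

/-- probability that the chain `q` of length `D` is open exactly to depth `i` -/
local notation3 "pd[" D ", " q ", " i "]" =>
  (∏ i' ∈ Finset.range (i : ℕ), (q : ℕ → ℝ) i') * (if (i : ℕ) < (D : ℕ) then 1 - (q : ℕ → ℝ) i else 1)

/-- mass counted at depth `i` in blob configuration `S` -/
local notation3 "mass[" lv ", " a ", " i ", " S "]" =>
  ∑ k ∈ (S : Finset κ).filter (fun k => (lv : κ → ℕ) k ≤ (i : ℕ)), ((a : κ → ℕ) k : ℕ)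

/-- the tail `P(N ≥ j+1)` of the block-comb count, as an explicit finite sum -/
local notation3 "TAIL[" D ", " q ", " lv ", " a ", " g ", " j "]" =>
  ∑ i ∈ Finset.range ((D : ℕ) + 1), pd[D, q, i] *
    ∑ S : Finset κ, wt[g, S] * (if (j : ℕ) + 1 ≤ mass[lv, a, i, S] then (1 : ℝ) else 0)

/-! ### 1. The tail is affine in the first chain gate -/

/-- **The first gate replaced by `t`.**  `TAIL[D+1, update q 0 t] = (1 − t)·A₀ + t·TAIL[D, q∘succ, lv − 1]` with the same `A₀` and the
same contracted tail (neither involves the first gate). [this work] -/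
theorem tail_rootGate_update_affine (D : ℕ) (q : ℕ → ℝ) (lv : κ → ℕ) (a : κ → ℕ) (g : κ → ℝ) (j : ℕ) (t : ℝ) :
    TAIL[D + 1, Function.update q 0 t, lv, a, g, j] =
      (1 - t) * (∑ S : Finset κ, wt[g, S] * (if j + 1 ≤ mass[lv, a, 0, S] then (1 : ℝ) else 0)) +
        t * TAIL[D, (fun i => q (i + 1)), (fun k => lv k - 1), a, g, j] := by
  have hq : (fun i => Function.update q 0 t (i + 1)) = fun i => q (i + 1) :=
    funext fun i => Function.update_of_ne (Nat.succ_ne_zero i) t q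
  have h := BlockCombGate.tail_succ D (Function.update q 0 t) lv a g j
  rw [Function.update_self, hq] at h
  exact h

/-- **FAR transfers down the first chain gate (general form, no root-mass hypothesis).**  For private gates in `[0,1]`,
`0 ≤ q 0 ≤ t` and `0 < t`: `(q 0/t)·TAIL[update q 0 t] ≤ TAIL[q]`.  Proof: both tails are `(1 − ·)·A₀ + (·)·T₁` with `A₀ ≥ 0`, and
the difference is `A₀·(1 − q 0/t) ≥ 0`. [this work] -/
theorem tail_ge_rootGate_mul_of_le (D : ℕ) (q : ℕ → ℝ) (lv : κ → ℕ) (a : κ → ℕ) (g : κ → ℝ)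
    (hg : ∀ k, 0 ≤ g k ∧ g k ≤ 1) (j : ℕ) (t : ℝ) (hq0 : 0 ≤ q 0) (hqt : q 0 ≤ t) (ht : 0 < t) :
    q 0 / t * TAIL[D + 1, Function.update q 0 t, lv, a, g, j] ≤ TAIL[D + 1, q, lv, a, g, j] := by
  rw [tail_rootGate_update_affine D q lv a g j t, BlockCombGate.tail_succ D q lv a g j]
  set A0 : ℝ := ∑ S : Finset κ, wt[g, S] * (if j + 1 ≤ mass[lv, a, 0, S] then (1 : ℝ) else 0) with hA0
  set T1 : ℝ := TAIL[D, (fun i => q (i + 1)), (fun k => lv k - 1), a, g, j] with hT1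
  have hA0nn : 0 ≤ A0 :=
    Finset.sum_nonneg fun S _ => mul_nonneg (wt_nonneg g hg S) (by split_ifs <;> norm_num)
  have hr : q 0 / t ≤ 1 := (div_le_one ht).2 hqt
  have hrt : q 0 / t * t = q 0 := div_mul_cancel₀ (q 0) ht.ne'
  have hmul : q 0 / t * A0 ≤ 1 * A0 := mul_le_mul_of_nonneg_right hr hA0nn
  have hq0' := hq0
  calc q 0 / t * ((1 - t) * A0 + t * T1)
      = q 0 / t * A0 - (q 0 / t * t) * A0 + (q 0 / t * t) * T1 := by ring
    _ = q 0 / t * A0 - q 0 * A0 + q 0 * T1 := by rw [hrt]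
    _ ≤ 1 * A0 - q 0 * A0 + q 0 * T1 := by linarith
    _ = (1 - q 0) * A0 + q 0 * T1 := by ring

/-- **FAR at a larger first gate gives FAR at the original one.**  `0 ≤ q 0 ≤ t`, `0 < t`: if `t·y ≤ TAIL[update q 0 t]` then
`q 0·y ≤ TAIL[q]`.  (Use: `y` = the floor of the contracted instance, so `t·y` and `q 0·y` are the floors at first gate `t` and
`q 0`; raising the first gate only raises the mean, so FAR may be proved at the first gate at which the least reliable root blob
becomes tied — lead g13's normal form N24 (1), now WITHOUT the hypothesis 'root mass ≤ j'.) [this work] -/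
theorem tail_ge_of_rootGate_le (D : ℕ) (q : ℕ → ℝ) (lv : κ → ℕ) (a : κ → ℕ) (g : κ → ℝ)
    (hg : ∀ k, 0 ≤ g k ∧ g k ≤ 1) (j : ℕ) (hq0 : 0 ≤ q 0) (t : ℝ) (hqt : q 0 ≤ t) (ht : 0 < t) (y : ℝ)
    (hfar : t * y ≤ TAIL[D + 1, Function.update q 0 t, lv, a, g, j]) :
    q 0 * y ≤ TAIL[D + 1, q, lv, a, g, j] := by
  have h1 : q 0 * y = q 0 / t * (t * y) := by
    field_simp
  have hr0 : 0 ≤ q 0 / t := div_nonneg hq0 ht.le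
  calc q 0 * y = q 0 / t * (t * y) := h1
    _ ≤ q 0 / t * TAIL[D + 1, Function.update q 0 t, lv, a, g, j] := mul_le_mul_of_nonneg_left hfar hr0
    _ ≤ TAIL[D + 1, q, lv, a, g, j] := tail_ge_rootGate_mul_of_le D q lv a g hg j t hq0 hqt ht

/-! ### 2. Appending a chain gate below every live blob -/

/-- **Appending a chain gate below every live blob does not change the tail.**  With live levels `≤ D`, replacing gate `D` (unused)
by any `t` and reading the chain as `D+1` gates gives the same tail. [this work] -/
theorem tail_append_gate (D : ℕ) (q : ℕ → ℝ) (lv : κ → ℕ) (a : κ → ℕ) (g : κ → ℝ) (j : ℕ) (t : ℝ)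
    (hlv : ∀ k, 0 < a k → lv k ≤ D) :
    TAIL[D + 1, Function.update q D t, lv, a, g, j] = TAIL[D, q, lv, a, g, j] := by
  -- prefix products below `D` do not see the new gate
  have hpre : ∀ i, i ≤ D → ∏ i' ∈ Finset.range i, Function.update q D t i' = ∏ i' ∈ Finset.range i, q i' := by
    intro i hi
    refine Finset.prod_congr rfl fun i' hi' => ?_
    have hne : i' ≠ D := by have := Finset.mem_range.1 hi'; omega
    rw [Function.update_of_ne hne]
  -- the mass at depth `D+1` equals the mass at depth `D` (no live blob at level `D+1`)
  have hmassD : ∀ S : Finset κ, mass[lv, a, D + 1, S] = mass[lv, a, D, S] := by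
    intro S
    symm
    refine Finset.sum_subset ?_ ?_
    · intro k hk
      rw [Finset.mem_filter] at hk ⊢
      exact ⟨hk.1, by omega⟩
    · intro k hk hk'
      rw [Finset.mem_filter] at hk hk'
      by_contra hak
      have := hlv k (Nat.pos_of_ne_zero hak)
      exact hk' ⟨hk.1, this⟩
  set F : ℕ → ℝ := fun i => ∑ S : Finset κ, wt[g, S] * (if j + 1 ≤ mass[lv, a, i, S] then (1 : ℝ) else 0) with hF
  have hFD : F (D + 1) = F D := by
    simp only [hF]
    exact Finset.sum_congr rfl fun S _ => by rw [hmassD S]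
  -- split both sums at the top
  have hL : TAIL[D + 1, Function.update q D t, lv, a, g, j] =
      ∑ i ∈ Finset.range D, pd[D + 1, Function.update q D t, i] * F i +
        (pd[D + 1, Function.update q D t, D] * F D + pd[D + 1, Function.update q D t, D + 1] * F (D + 1)) := by
    rw [Finset.sum_range_succ, Finset.sum_range_succ, add_assoc]
  have hR : TAIL[D, q, lv, a, g, j] = ∑ i ∈ Finset.range D, pd[D, q, i] * F i + pd[D, q, D] * F D := by
    rw [Finset.sum_range_succ]
  rw [hL, hR]
  congr 1
  · refine Finset.sum_congr rfl fun i hi => ?_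
    have hiD : i < D := Finset.mem_range.1 hi
    congr 1
    show (∏ i' ∈ Finset.range i, Function.update q D t i') * (if i < D + 1 then 1 - Function.update q D t i else 1) =
      (∏ i' ∈ Finset.range i, q i') * (if i < D then 1 - q i else 1)
    rw [hpre i hiD.le, if_pos (by omega), if_pos hiD, Function.update_of_ne (by omega)]
  · rw [hFD]
    have h1 : pd[D + 1, Function.update q D t, D] = (∏ i' ∈ Finset.range D, q i') * (1 - t) := by
      show (∏ i' ∈ Finset.range D, Function.update q D t i') * (if D < D + 1 then 1 - Function.update q D t D else 1) = _
      rw [hpre D le_rfl, if_pos (Nat.lt_succ_self D), Function.update_self]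
    have h2 : pd[D + 1, Function.update q D t, D + 1] = (∏ i' ∈ Finset.range D, q i') * t := by
      show (∏ i' ∈ Finset.range (D + 1), Function.update q D t i') *
          (if D + 1 < D + 1 then 1 - Function.update q D t (D + 1) else 1) = _
      rw [if_neg (lt_irrefl _), mul_one, Finset.prod_range_succ, hpre D le_rfl, Function.update_self]
    have h3 : pd[D, q, D] = ∏ i' ∈ Finset.range D, q i' := by
      show (∏ i' ∈ Finset.range D, q i') * (if D < D then 1 - q D else 1) = _
      rw [if_neg (lt_irrefl _), mul_one]
    rw [h1, h2, h3]
    ring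


end BlockComb

end Quant

end Summit.CriticalPhenomena.PercolationContinuityZ3.Theorems
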